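import Mathlib
import HarnessLib
import Summits.ResolutionOfSingularities.ResolutionOfSingularities.Theses.EquisingularLift

/-!
# Birth skeleton (BC3) of the child `IsolatedPointDrop` of `EquisingularLift` (stmt-ResolutionOfSingularities-15660)

Line `birth` (crux-strategist BC2 redirect, 2026-08-17, rev b). `IsolatedPointDrop` = child 2/2 of the STRATA split of
`EquisingularLift`: at any intermediate stage `(P₁, σ₁, S₁)` of a liftable horizontal regular blow-up chain over
`(P ⊇ Y)` (complete char-0 DVR `O` with algebraically closed residue field; `P/O` smooth proper; `Y ⊆ P_s` irreducible
closed) whose reduced iterated strict transform `V(closure S₁)` has FINITELY MANY (≥ 1) non-regular points, at each of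
which the ambient has GOOD REDUCTION (`GoodAt`), a further chain over `(P₁, closure S₁)` (regular centres off the generic
point of the strict transform, irreducible total special fibre) STRICTLY LOWERS the number of non-regular points, keeping
finiteness and good reduction at the remaining ones.

The cut (two named stubs; `IsolatedPointDrop_of` PROVED — an injection/cardinal argument, sorries only inside the stubs):
* `stub_resolveOnePoint` (OPEN — the load-bearing stub): ONE isolated singular point `x₀` (at a point of good reduction
  of the ambient) is resolved by a liftable chain that is an ISOMORPHISM over an open `V ⊆ P₁` containing every other
  point of `V(closure S₁)` (all centres over `x₀`: over a complete `O` a horizontal centre with special fibre at `x₀`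
  never meets the generizations of the other special points) and after which every point of the new strict transform
  over `x₀` is regular ("liftable embedded resolution of one isolated singularity in a smooth `O`-ambient germ" — plane
  curves: Ishii 2025 Cor 1.5 / point blow-ups lift as `W(k)`-sections; rational double points: Artin 1977).
* `stub_regularOverIso` (STRUCTURAL, true, M-sized): where the chain is an isomorphism over `V`, a point of the new
  reduced strict transform is regular iff the point under it is, and the ambient has good reduction at it iff it had
  below (everything is transported along the isomorphism `σ₂⁻¹V ≅ V`, which carries `closure S₂ ∩ σ₂⁻¹V` onto
  `closure S₁ ∩ V` because `closure S₂ = closure {ξ₂}` with `σ₂⁻¹(ξ₁) = {ξ₂}`).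
`IsolatedPointDrop_of`: send each non-regular `z` of `V(closure S₂)` to the point `x(z)` of `V(closure S₁)` under it
(`σ₂` maps `closure S₂ = closure {ξ₂}` into `closure S₁ = closure {ξ₁}`, `Chain.fibre`); `x(z) ≠ x₀` (points over `x₀`
are regular), so `x(z) ∈ V`, so `x(z)` is non-regular with the same good-reduction status (`stub_regularOverIso`) and
`z ↦ x(z)` is injective on non-regular points (`σ₂` is injective over `V`, `j₂` is a closed immersion); hence
`Sing₂ ↪ Sing₁ ∖ {x₀}`: finite, good reduction inherited, and `#Sing₂ ≤ #Sing₁ − 1 < #Sing₁`.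
-/

set_option linter.dupNamespace false

noncomputable section

open CategoryTheory AlgebraicGeometry TopologicalSpace Topology
open Literature.AlgebraicGeometry.Resolution

namespace Summit.ResolutionOfSingularities.ResolutionOfSingularities.Cruxes.IsolatedPointDrop.Birth

/-- VERBATIM mirror of the child statement `EquisingularLift.IsolatedPointDrop` (rev b; not yet a route decl: the split
is filed with this skeleton; afterwards the conclusion is the route decl by `Iff.rfl`). -/
def IsolatedPointDrop : Prop :=
  ∀ (O : Type) [CommRing O] [IsDomain O] [IsDiscreteValuationRing O] [CharZero O] [IsAdicComplete (IsLocalRing.maximalIdeal O) O] [IsAlgClosed (IsLocalRing.ResidueField O)] (P P₁ : AlgebraicGeometry.Scheme.{0}) (q : P ⟶ AlgebraicGeometry.Spec (.of O)) (Y : TopologicalSpace.Closeds P) (σ₁ : P₁ ⟶ P) (S₁ : Set P₁), AlgebraicGeometry.Smooth q → AlgebraicGeometry.IsProper q → (Y : Set P) ⊆ q ⁻¹' {IsLocalRing.closedPoint O} → IsIrreducible (Y : Set P) → (∀ Q : (∀ X' : AlgebraicGeometry.Scheme.{0}, (X' ⟶ P) → Set X' → Prop), Q P (CategoryTheory.CategoryStruct.id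 P) (Y : Set P) → (∀ (X' X'' : AlgebraicGeometry.Scheme.{0}) (σ' : X' ⟶ P) (Y' : Set X') (C : X'.IdealSheafData) (τ : X'' ⟶ X'), Q X' σ' Y' → Literature.AlgebraicGeometry.Resolution.IsBlowup τ C → Literature.AlgebraicGeometry.Resolution.Scheme.IsRegular C.subscheme → σ' '' (C.support : Set X') ⊆ {x : P | ¬ IsGenericPoint x (Y : Set P)} → Q X'' (CategoryTheory.CategoryStruct.comp τ σ') (closure (τ ⁻¹' (Y' \ (C.support : Set X'))))) → Q P₁ σ₁ S₁) → IsIrreducible (((CategoryTheory.CategoryStruct.comp σ₁ q)) ⁻¹' {IsLocalRing.closedPoint O}) → Set.Finite {x : ↥(AlgebraicGeometry.Scheme.IdealSheafData.vanishingIdeal (⟨closure S₁, isClosed_closure⟩ : TopologicalSpace.Closeds P₁)).subscheme | ¬ IsRegularLocalRing ((AlgebraicGeometry.Scheme.IdealSheafData.vanishingIdeal (⟨closure S₁, isClosed_closure⟩ : TopologicalSpace.Closeds P₁)).subscheme.presheaf.stalk x)} → (∀ x : ↥(AlgebraicGeometry.Scheme.IdealSheafData.vanishingIdeal (⟨closure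 S₁, isClosed_closure⟩ : TopologicalSpace.Closeds P₁)).subscheme, ¬ IsRegularLocalRing ((AlgebraicGeometry.Scheme.IdealSheafData.vanishingIdeal (⟨closure S₁, isClosed_closure⟩ : TopologicalSpace.Closeds P₁)).subscheme.presheaf.stalk x) → IsRegularLocalRing (P₁.presheaf.stalk ((AlgebraicGeometry.Scheme.IdealSheafData.vanishingIdeal (⟨closure S₁, isClosed_closure⟩ : TopologicalSpace.Closeds P₁)).subschemeι x)) ∧ ∀ ϖ : O, Irreducible ϖ → (P₁.presheaf.Γgerm ((AlgebraicGeometry.Scheme.IdealSheafData.vanishingIdeal (⟨closure S₁, isClosed_closure⟩ : TopologicalSpace.Closeds P₁)).subschemeι x)).hom (((CategoryTheory.CategoryStruct.comp σ₁ q)).appTop.hom ((AlgebraicGeometry.Scheme.ΓSpecIso (CommRingCat.of O)).inv.hom ϖ)) ∉ (IsLocalRing.maximalIdeal (P₁.presheaf.stalk ((AlgebraicGeometry.Scheme.IdealSheafData.vanishingIdeal (⟨closure S₁, isClosed_closure⟩ : TopologicalSpace.Closeds P₁)).subschemeι x))) ^ 2) → Set.Nonempty {x : ↥(AlgebraicGeometry.Scheme.IdealSheafData.vanishingIdeal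 (⟨closure S₁, isClosed_closure⟩ : TopologicalSpace.Closeds P₁)).subscheme | ¬ IsRegularLocalRing ((AlgebraicGeometry.Scheme.IdealSheafData.vanishingIdeal (⟨closure S₁, isClosed_closure⟩ : TopologicalSpace.Closeds P₁)).subscheme.presheaf.stalk x)} → ∃ (P₂ : AlgebraicGeometry.Scheme.{0}) (σ₂ : P₂ ⟶ P₁) (S₂ : Set P₂), (∀ Q : (∀ X' : AlgebraicGeometry.Scheme.{0}, (X' ⟶ P₁) → Set X' → Prop), Q P₁ (CategoryTheory.CategoryStruct.id P₁) (closure S₁) → (∀ (X' X'' : AlgebraicGeometry.Scheme.{0}) (σ' : X' ⟶ P₁) (Y' : Set X') (C : X'.IdealSheafData) (τ : X'' ⟶ X'), Q X' σ' Y' → Literature.AlgebraicGeometry.Resolution.IsBlowup τ C → Literature.AlgebraicGeometry.Resolution.Scheme.IsRegular C.subscheme → σ' '' (C.support : Set X') ⊆ {x : P₁ | ¬ IsGenericPoint x (closure S₁)} → Q X'' (CategoryTheory.CategoryStruct.comp τ σ') (closure (τ ⁻¹' (Y' \ (C.support : Set X'))))) → Q P₂ σ₂ S₂) ∧ IsIrreducible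 (((CategoryTheory.CategoryStruct.comp (CategoryTheory.CategoryStruct.comp σ₂ σ₁) q)) ⁻¹' {IsLocalRing.closedPoint O}) ∧ Set.Finite {x : ↥(AlgebraicGeometry.Scheme.IdealSheafData.vanishingIdeal (⟨closure S₂, isClosed_closure⟩ : TopologicalSpace.Closeds P₂)).subscheme | ¬ IsRegularLocalRing ((AlgebraicGeometry.Scheme.IdealSheafData.vanishingIdeal (⟨closure S₂, isClosed_closure⟩ : TopologicalSpace.Closeds P₂)).subscheme.presheaf.stalk x)} ∧ (∀ x : ↥(AlgebraicGeometry.Scheme.IdealSheafData.vanishingIdeal (⟨closure S₂, isClosed_closure⟩ : TopologicalSpace.Closeds P₂)).subscheme, ¬ IsRegularLocalRing ((AlgebraicGeometry.Scheme.IdealSheafData.vanishingIdeal (⟨closure S₂, isClosed_closure⟩ : TopologicalSpace.Closeds P₂)).subscheme.presheaf.stalk x) → IsRegularLocalRing (P₂.presheaf.stalk ((AlgebraicGeometry.Scheme.IdealSheafData.vanishingIdeal (⟨closure S₂, isClosed_closure⟩ : TopologicalSpace.Closeds P₂)).subschemeι x)) ∧ ∀ ϖ : O, Irreducible ϖ →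 (P₂.presheaf.Γgerm ((AlgebraicGeometry.Scheme.IdealSheafData.vanishingIdeal (⟨closure S₂, isClosed_closure⟩ : TopologicalSpace.Closeds P₂)).subschemeι x)).hom (((CategoryTheory.CategoryStruct.comp (CategoryTheory.CategoryStruct.comp σ₂ σ₁) q)).appTop.hom ((AlgebraicGeometry.Scheme.ΓSpecIso (CommRingCat.of O)).inv.hom ϖ)) ∉ (IsLocalRing.maximalIdeal (P₂.presheaf.stalk ((AlgebraicGeometry.Scheme.IdealSheafData.vanishingIdeal (⟨closure S₂, isClosed_closure⟩ : TopologicalSpace.Closeds P₂)).subschemeι x))) ^ 2) ∧ Set.ncard {x : ↥(AlgebraicGeometry.Scheme.IdealSheafData.vanishingIdeal (⟨closure S₂, isClosed_closure⟩ : TopologicalSpace.Closeds P₂)).subscheme | ¬ IsRegularLocalRing ((AlgebraicGeometry.Scheme.IdealSheafData.vanishingIdeal (⟨closure S₂, isClosed_closure⟩ : TopologicalSpace.Closeds P₂)).subscheme.presheaf.stalk x)} < Set.ncard {x : ↥(AlgebraicGeometry.Scheme.IdealSheafData.vanishingIdeal (⟨closure S₁, isClosed_closure⟩ : TopologicalSpace.Closeds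 P₁)).subscheme | ¬ IsRegularLocalRing ((AlgebraicGeometry.Scheme.IdealSheafData.vanishingIdeal (⟨closure S₁, isClosed_closure⟩ : TopologicalSpace.Closeds P₁)).subscheme.presheaf.stalk x)}

/-! ## Helper notions used only in the proofs (each unfolds, by `Iff.rfl`, to the inlined text above) -/

/-- The recursor-encoded chain of blow-ups in regular centres off the generic point(s) of `Y`
(verbatim the fifth conjunct of `EquisingularLift`, abstracted in `P, Y, P', σ, S'`). -/
def Chain (P : Scheme.{0}) (Y : Set P) (P' : Scheme.{0}) (σ : P' ⟶ P) (S' : Set P') : Prop :=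
  ∀ Q : (∀ X' : AlgebraicGeometry.Scheme.{0}, (X' ⟶ P) → Set X' → Prop),
    Q P (CategoryTheory.CategoryStruct.id P) Y →
    (∀ (X' X'' : AlgebraicGeometry.Scheme.{0}) (σ' : X' ⟶ P) (Y' : Set X') (C : X'.IdealSheafData)
      (τ : X'' ⟶ X'), Q X' σ' Y' → Literature.AlgebraicGeometry.Resolution.IsBlowup τ C →
      Literature.AlgebraicGeometry.Resolution.Scheme.IsRegular C.subscheme →
      σ' '' (C.support : Set X') ⊆ {x : P | ¬ IsGenericPoint x Y} →
      Q X'' (CategoryTheory.CategoryStruct.comp τ σ') (closure (τ ⁻¹' (Y' \ (C.support : Set X'))))) →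
    Q P' σ S'

/-- The non-regular locus of the reduced closed subscheme on `closure S'`. -/
def singSet {P' : Scheme.{0}} (S' : Set P') : Set ↥((Scheme.IdealSheafData.vanishingIdeal
    (⟨closure S', isClosed_closure⟩ : Closeds P')).subscheme) :=
  {x | ¬ IsRegularLocalRing (((Scheme.IdealSheafData.vanishingIdeal
    (⟨closure S', isClosed_closure⟩ : Closeds P')).subscheme).presheaf.stalk x)}

/-- GOOD REDUCTION OF THE AMBIENT AT A POINT: the ambient `P'` (with structure morphism `r` to `Spec O`) is
regular at `y` and the uniformizer of `O` is a regular PARAMETER there (`ϖ ∉ 𝔪_y²`) — for the `O`-flat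
finite-type stages of a chain this says exactly that `P' → Spec O` is smooth at `y` (regular special fibre at
`y`, residue field of `O` algebraically closed). -/
def GoodAt {O : Type} [CommRing O] {P' : Scheme.{0}} (r : P' ⟶ Spec (.of O)) (y : P') : Prop :=
  IsRegularLocalRing (P'.presheaf.stalk y) ∧
    ∀ ϖ : O, Irreducible ϖ → (P'.presheaf.Γgerm y).hom (r.appTop.hom ((Scheme.ΓSpecIso (.of O)).inv.hom ϖ)) ∉
      (IsLocalRing.maximalIdeal (P'.presheaf.stalk y)) ^ 2

/-- The good-reduction clause of the split: the ambient has good reduction at every NON-REGULAR point of the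
reduced strict transform `V(closure S')`. -/
def GoodSet {O : Type} [CommRing O] {P' : Scheme.{0}} (r : P' ⟶ Spec (.of O)) (S' : Set P') : Prop :=
  ∀ x : ↥((Scheme.IdealSheafData.vanishingIdeal (⟨closure S', isClosed_closure⟩ : Closeds P')).subscheme),
    ¬ IsRegularLocalRing (((Scheme.IdealSheafData.vanishingIdeal
      (⟨closure S', isClosed_closure⟩ : Closeds P')).subscheme).presheaf.stalk x) →
    GoodAt r ((Scheme.IdealSheafData.vanishingIdeal (⟨closure S', isClosed_closure⟩ : Closeds P')).subschemeι x)


/-! ## Structure of a chain over an irreducible closed set (proved; shared with the split assembly) -/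

/-- If `g` is an isomorphism over the open `W`, every point of `W` has exactly one preimage.
[folklore; inlined from `Literature…EmbeddedResolution`, whose import cone is not route-clean] -/
theorem existsUnique_preimage {A B : Scheme.{0}} (g : A ⟶ B) {W : B.Opens} (hW : IsIso (g ∣_ W))
    {y : B} (hy : y ∈ W) : ∃! x : A, g x = y := by
  let eW := Scheme.homeoOfIso (asIso (g ∣_ W))
  have he : ∀ z : ↥((Opens.map g.base).obj W), (eW z).1 = g z.1 := fun z =>
    morphismRestrict_base_coe g W z
  let y' : ↥(W : Scheme.{0}) := ⟨y, hy⟩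
  refine ⟨(eW.symm y').1,
    (he _).symm.trans (congrArg Subtype.val (eW.apply_symm_apply y')), ?_⟩
  intro x (hx : g x = y)
  have hxW : x ∈ (Opens.map g.base).obj W := show g x ∈ W by rw [hx]; exact hy
  have hex : eW ⟨x, hxW⟩ = y' := Subtype.ext ((he _).trans hx)
  exact (congrArg Subtype.val (eW.symm_apply_apply ⟨x, hxW⟩)).symm.trans
    (congrArg (fun w => (eW.symm w).1) hex)

/-- If `g` is an isomorphism over the open `W`, images of open subsets of `g ⁻¹ W` are open. [folklore] -/
theorem isOpen_image {A B : Scheme.{0}} (g : A ⟶ B) {W : B.Opens} (hW : IsIso (g ∣_ W))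
    {S : Set A} (hS : IsOpen S) (hSW : S ⊆ ((Opens.map g.base).obj W : Set A)) : IsOpen (g '' S) := by
  let eW := Scheme.homeoOfIso (asIso (g ∣_ W))
  have he : ∀ z : ↥((Opens.map g.base).obj W), (eW z).1 = g z.1 := fun z =>
    morphismRestrict_base_coe g W z
  have himg : g '' S = W.ι '' (eW '' (Scheme.Opens.ι ((Opens.map g.base).obj W) ⁻¹' S)) := by
    ext y
    constructor
    · rintro ⟨x, hx, rfl⟩
      exact ⟨eW ⟨x, hSW hx⟩, ⟨⟨x, hSW hx⟩, hx, rfl⟩, he _⟩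
    · rintro ⟨_, ⟨z, hz, rfl⟩, rfl⟩
      exact ⟨z.1, hz, (he z).symm⟩
  rw [himg]
  exact W.ι.isOpenEmbedding.isOpenMap _
    (eW.isOpenMap _ (hS.preimage (Scheme.Opens.ι ((Opens.map g.base).obj W)).continuous))

/-- If `g` is an isomorphism over the open `W` and `B' ⊆ B`, every point of `g ⁻¹ W` over the closure
of `B'` lies in the closure of `g ⁻¹ B'`. [folklore] -/
theorem preimage_closure_inter_subset {A B : Scheme.{0}} (g : A ⟶ B) {W : B.Opens}
    (hW : IsIso (g ∣_ W)) (B' : Set B) :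
    g ⁻¹' closure B' ∩ ((Opens.map g.base).obj W : Set A) ⊆ closure (g ⁻¹' B') := by
  rintro x ⟨hxB, hxW⟩
  rw [mem_closure_iff]
  intro S hS hxS
  have hS' : IsOpen (g '' (S ∩ ((Opens.map g.base).obj W : Set A))) :=
    isOpen_image g hW (hS.inter ((Opens.map g.base).obj W).isOpen) Set.inter_subset_right
  obtain ⟨_, ⟨o, ⟨hoS, -⟩, rfl⟩, hoB⟩ := mem_closure_iff.mp hxB _ hS' ⟨x, ⟨hxS, hxW⟩, rfl⟩
  exact ⟨o, hoS, hoB⟩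

/-- STRUCTURE LEMMA. Along a chain starting from `Y = closure {ξ}`, the fibre over `ξ` stays a single
point `ξ'` and the iterated strict transform is `closure {ξ'}` (no properness needed: each blow-up is
an isomorphism off its centre, and the centre misses the point over `ξ`). -/
theorem Chain.fibre {P : Scheme.{0}} {Y : Set P} {P' : Scheme.{0}} {σ : P' ⟶ P} {S' : Set P'}
    (h : Chain P Y P' σ S') {ξ : P} (hξ : IsGenericPoint ξ Y) :
    ∃ ξ' : P', σ ⁻¹' {ξ} = {ξ'} ∧ S' = closure {ξ'} := by
  refine h (fun X' σ' Y' => ∃ ξ' : X', σ' ⁻¹' {ξ} = {ξ'} ∧ Y' = closure {ξ'}) ?_ ?_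
  · refine ⟨ξ, ?_, hξ.symm⟩
    ext x
    simp
  · intro X' X'' σ' Y' C τ hQ hτ _ hTC
    obtain ⟨ξ', hfib, hY'⟩ := hQ
    have hξ'σ : σ' ξ' = ξ := by
      have : ξ' ∈ σ' ⁻¹' {ξ} := by rw [hfib]; exact rfl
      simpa using this
    have hξ'C : ξ' ∉ (C.support : Set X') := by
      intro h'
      have := hTC ⟨ξ', h', hξ'σ⟩
      exact this hξ
    let Wc : X'.Opens := ⟨(C.support : Set X')ᶜ, C.support.isClosed.isOpen_compl⟩
    have hWc : IsIso (τ ∣_ Wc) := hτ.isIso_morphismRestrict disjoint_compl_left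
    obtain ⟨ξ₂, hξ₂, huniq⟩ := existsUnique_preimage τ hWc (y := ξ') hξ'C
    have hfibτ : τ ⁻¹' {ξ'} = {ξ₂} := by
      ext z
      simp only [Set.mem_preimage, Set.mem_singleton_iff]
      exact ⟨fun hz => huniq z hz, fun hz => hz ▸ hξ₂⟩
    refine ⟨ξ₂, ?_, ?_⟩
    · rw [show (CategoryStruct.comp τ σ') ⁻¹' {ξ} = τ ⁻¹' (σ' ⁻¹' {ξ}) from by
        ext z; simp, hfib, hfibτ]
    · apply le_antisymm
      · refine closure_minimal ?_ isClosed_closure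
        rintro x ⟨hxY, hxC⟩
        rw [hY'] at hxY
        have hx := preimage_closure_inter_subset τ hWc {ξ'} ⟨hxY, hxC⟩
        rwa [hfibτ] at hx
      · refine closure_mono (Set.singleton_subset_iff.mpr ⟨?_, ?_⟩)
        · rw [hY']
          show τ ξ₂ ∈ closure {ξ'}
          rw [hξ₂]
          exact subset_closure rfl
        · show τ ξ₂ ∉ (C.support : Set X')
          rw [hξ₂]
          exact hξ'C


/-! ## The stubs -/

/-- **STUB `stub_resolveOnePoint` (OPEN; load-bearing): liftable embedded resolution of ONE isolated singular point at
a point of good reduction.** With the hypotheses of `IsolatedPointDrop` and a non-regular point `x₀` of the reduced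
strict transform `V(closure S₁)`: there is a further chain of blow-ups in regular centres off the generic point of
`closure S₁`, with irreducible total special fibre (all centres horizontal), which is an ISOMORPHISM over an open
`V ⊆ P₁` containing all points of `V(closure S₁)` other than `x₀`, and after which every point of the new reduced
strict transform lying over `x₀` is regular. [cite: Ishii2025, Thm 1.1 / Cor 1.5; Artin1977; HauserPerlega2019, §3;
Kollar2026; arXiv:1005.4503, Thm 5 (finite determinacy ⇔ isolated)] -/
theorem stub_resolveOnePoint : ∀ (O : Type) [CommRing O] [IsDomain O] [IsDiscreteValuationRing O] [CharZero O] [IsAdicComplete (IsLocalRing.maximalIdeal O) O] [IsAlgClosed (IsLocalRing.ResidueField O)] (P P₁ : AlgebraicGeometry.Scheme.{0}) (q : P ⟶ AlgebraicGeometry.Spec (.of O)) (Y : TopologicalSpace.Closeds P) (σ₁ : P₁ ⟶ P) (S₁ : Set P₁), AlgebraicGeometry.Smooth q → AlgebraicGeometry.IsProper q → (Y : Set P) ⊆ q ⁻¹' {IsLocalRing.closedPoint O} → IsIrreducible (Y : Set P) → Chain P (Y : Set P) P₁ σ₁ S₁ → IsIrreducible (((CategoryTheory.CategoryStruct.comp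 σ₁ q)) ⁻¹' {IsLocalRing.closedPoint O}) → (singSet S₁).Finite → GoodSet ((CategoryTheory.CategoryStruct.comp σ₁ q)) S₁ → ∀ x₀ ∈ singSet S₁, ∃ (P₂ : AlgebraicGeometry.Scheme.{0}) (σ₂ : P₂ ⟶ P₁) (S₂ : Set P₂), Chain P₁ (closure S₁) P₂ σ₂ S₂ ∧ IsIrreducible (((CategoryTheory.CategoryStruct.comp (CategoryTheory.CategoryStruct.comp σ₂ σ₁) q)) ⁻¹' {IsLocalRing.closedPoint O}) ∧ ∃ V : P₁.Opens, (∀ x : ↥(AlgebraicGeometry.Scheme.IdealSheafData.vanishingIdeal (⟨closure S₁, isClosed_closure⟩ : TopologicalSpace.Closeds P₁)).subscheme, x ≠ x₀ → ((AlgebraicGeometry.Scheme.IdealSheafData.vanishingIdeal (⟨closure S₁, isClosed_closure⟩ : TopologicalSpace.Closeds P₁)).subschemeι x : P₁) ∈ V) ∧ CategoryTheory.IsIso (σ₂ ∣_ V) ∧ (∀ z : ↥(AlgebraicGeometry.Scheme.IdealSheafData.vanishingIdeal (⟨closure S₂, isClosed_closure⟩ : TopologicalSpace.Closeds P₂)).subscheme,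 (σ₂ ((AlgebraicGeometry.Scheme.IdealSheafData.vanishingIdeal (⟨closure S₂, isClosed_closure⟩ : TopologicalSpace.Closeds P₂)).subschemeι z) : P₁) = (AlgebraicGeometry.Scheme.IdealSheafData.vanishingIdeal (⟨closure S₁, isClosed_closure⟩ : TopologicalSpace.Closeds P₁)).subschemeι x₀ → IsRegularLocalRing ((AlgebraicGeometry.Scheme.IdealSheafData.vanishingIdeal (⟨closure S₂, isClosed_closure⟩ : TopologicalSpace.Closeds P₂)).subscheme.presheaf.stalk z)) := by
  sorry

/-- **STUB `stub_regularOverIso` (structural; true, M-sized): regularity of the strict transform and good reduction of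
the ambient are unchanged where the chain is an isomorphism.** If the chain `σ₂` over `(P₁, closure S₁)`
(irreducible) is an isomorphism over the open `V ⊆ P₁`, then for a point `z` of `V(closure S₂)` over a point `x` of
`V(closure S₁)` with `x ∈ V`: `z` is regular iff `x` is, and `GoodAt (σ₂ ≫ r₁) z ↔ GoodAt r₁ x` for any structure
morphism `r₁ : P₁ → Spec O`. [cite: GortzWedhorn2020, Prop. 13.91 (3); StacksProject, Tag 01J3] -/
theorem stub_regularOverIso : ∀ (O : Type) [CommRing O] (P₁ P₂ : AlgebraicGeometry.Scheme.{0}) (r₁ : P₁ ⟶ AlgebraicGeometry.Spec (.of O)) (σ₂ : P₂ ⟶ P₁) (S₁ : Set P₁) (S₂ : Set P₂) (V : P₁.Opens), IsIrreducible (closure S₁) → Chain P₁ (closure S₁) P₂ σ₂ S₂ → CategoryTheory.IsIso (σ₂ ∣_ V) → ∀ (z : ↥(AlgebraicGeometry.Scheme.IdealSheafData.vanishingIdeal (⟨closure S₂, isClosed_closure⟩ : TopologicalSpace.Closeds P₂)).subscheme) (x : ↥(AlgebraicGeometry.Scheme.IdealSheafData.vanishingIdeal (⟨closure S₁, isClosed_closure⟩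 : TopologicalSpace.Closeds P₁)).subscheme), (σ₂ ((AlgebraicGeometry.Scheme.IdealSheafData.vanishingIdeal (⟨closure S₂, isClosed_closure⟩ : TopologicalSpace.Closeds P₂)).subschemeι z) : P₁) = (AlgebraicGeometry.Scheme.IdealSheafData.vanishingIdeal (⟨closure S₁, isClosed_closure⟩ : TopologicalSpace.Closeds P₁)).subschemeι x → ((AlgebraicGeometry.Scheme.IdealSheafData.vanishingIdeal (⟨closure S₁, isClosed_closure⟩ : TopologicalSpace.Closeds P₁)).subschemeι x : P₁) ∈ V → (IsRegularLocalRing ((AlgebraicGeometry.Scheme.IdealSheafData.vanishingIdeal (⟨closure S₂, isClosed_closure⟩ : TopologicalSpace.Closeds P₂)).subscheme.presheaf.stalk z) ↔ IsRegularLocalRing ((AlgebraicGeometry.Scheme.IdealSheafData.vanishingIdeal (⟨closure S₁, isClosed_closure⟩ : TopologicalSpace.Closeds P₁)).subscheme.presheaf.stalk x)) ∧ (GoodAt ((CategoryTheory.CategoryStruct.comp σ₂ r₁)) ((AlgebraicGeometry.Scheme.IdealSheafData.vanishingIdeal (⟨closure S₂, isClosed_closure⟩ : TopologicalSpace.Closeds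 P₂)).subschemeι z) ↔ GoodAt r₁ ((AlgebraicGeometry.Scheme.IdealSheafData.vanishingIdeal (⟨closure S₁, isClosed_closure⟩ : TopologicalSpace.Closeds P₁)).subschemeι x)) := by
  sorry

/-! ## The composition (kernel-checked; no `sorry` in its own term) -/

/-- **`IsolatedPointDrop` from the two stub statements**: resolve one singular point `x₀` over an open `V ∌ x₀` where
nothing changes; the non-regular points of the new strict transform inject into the old ones minus `x₀`, inheriting
good reduction. -/
theorem IsolatedPointDrop_of :
    (∀ (O : Type) [CommRing O] [IsDomain O] [IsDiscreteValuationRing O] [CharZero O] [IsAdicComplete (IsLocalRing.maximalIdeal O) O] [IsAlgClosed (IsLocalRing.ResidueField O)] (P P₁ : AlgebraicGeometry.Scheme.{0}) (q : P ⟶ AlgebraicGeometry.Spec (.of O)) (Y : TopologicalSpace.Closeds P) (σ₁ : P₁ ⟶ P) (S₁ : Set P₁), AlgebraicGeometry.Smooth q → AlgebraicGeometry.IsProper q → (Y : Set P) ⊆ q ⁻¹' {IsLocalRing.closedPoint O} → IsIrreducible (Y : Set P) → Chain P (Y : Set P) P₁ σ₁ S₁ → IsIrreducible (((CategoryTheory.CategoryStruct.comp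 σ₁ q)) ⁻¹' {IsLocalRing.closedPoint O}) → (singSet S₁).Finite → GoodSet ((CategoryTheory.CategoryStruct.comp σ₁ q)) S₁ → ∀ x₀ ∈ singSet S₁, ∃ (P₂ : AlgebraicGeometry.Scheme.{0}) (σ₂ : P₂ ⟶ P₁) (S₂ : Set P₂), Chain P₁ (closure S₁) P₂ σ₂ S₂ ∧ IsIrreducible (((CategoryTheory.CategoryStruct.comp (CategoryTheory.CategoryStruct.comp σ₂ σ₁) q)) ⁻¹' {IsLocalRing.closedPoint O}) ∧ ∃ V : P₁.Opens, (∀ x : ↥(AlgebraicGeometry.Scheme.IdealSheafData.vanishingIdeal (⟨closure S₁, isClosed_closure⟩ : TopologicalSpace.Closeds P₁)).subscheme, x ≠ x₀ → ((AlgebraicGeometry.Scheme.IdealSheafData.vanishingIdeal (⟨closure S₁, isClosed_closure⟩ : TopologicalSpace.Closeds P₁)).subschemeι x : P₁) ∈ V) ∧ CategoryTheory.IsIso (σ₂ ∣_ V) ∧ (∀ z : ↥(AlgebraicGeometry.Scheme.IdealSheafData.vanishingIdeal (⟨closure S₂, isClosed_closure⟩ : TopologicalSpace.Closeds P₂)).subscheme,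 (σ₂ ((AlgebraicGeometry.Scheme.IdealSheafData.vanishingIdeal (⟨closure S₂, isClosed_closure⟩ : TopologicalSpace.Closeds P₂)).subschemeι z) : P₁) = (AlgebraicGeometry.Scheme.IdealSheafData.vanishingIdeal (⟨closure S₁, isClosed_closure⟩ : TopologicalSpace.Closeds P₁)).subschemeι x₀ → IsRegularLocalRing ((AlgebraicGeometry.Scheme.IdealSheafData.vanishingIdeal (⟨closure S₂, isClosed_closure⟩ : TopologicalSpace.Closeds P₂)).subscheme.presheaf.stalk z))) →
    (∀ (O : Type) [CommRing O] (P₁ P₂ : AlgebraicGeometry.Scheme.{0}) (r₁ : P₁ ⟶ AlgebraicGeometry.Spec (.of O)) (σ₂ : P₂ ⟶ P₁) (S₁ : Set P₁) (S₂ : Set P₂) (V : P₁.Opens), IsIrreducible (closure S₁) → Chain P₁ (closure S₁) P₂ σ₂ S₂ → CategoryTheory.IsIso (σ₂ ∣_ V) → ∀ (z : ↥(AlgebraicGeometry.Scheme.IdealSheafData.vanishingIdeal (⟨closure S₂, isClosed_closure⟩ : TopologicalSpace.Closeds P₂)).subscheme) (x : ↥(AlgebraicGeometry.Scheme.IdealSheafData.vanishingIdeal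 (⟨closure S₁, isClosed_closure⟩ : TopologicalSpace.Closeds P₁)).subscheme), (σ₂ ((AlgebraicGeometry.Scheme.IdealSheafData.vanishingIdeal (⟨closure S₂, isClosed_closure⟩ : TopologicalSpace.Closeds P₂)).subschemeι z) : P₁) = (AlgebraicGeometry.Scheme.IdealSheafData.vanishingIdeal (⟨closure S₁, isClosed_closure⟩ : TopologicalSpace.Closeds P₁)).subschemeι x → ((AlgebraicGeometry.Scheme.IdealSheafData.vanishingIdeal (⟨closure S₁, isClosed_closure⟩ : TopologicalSpace.Closeds P₁)).subschemeι x : P₁) ∈ V → (IsRegularLocalRing ((AlgebraicGeometry.Scheme.IdealSheafData.vanishingIdeal (⟨closure S₂, isClosed_closure⟩ : TopologicalSpace.Closeds P₂)).subscheme.presheaf.stalk z) ↔ IsRegularLocalRing ((AlgebraicGeometry.Scheme.IdealSheafData.vanishingIdeal (⟨closure S₁, isClosed_closure⟩ : TopologicalSpace.Closeds P₁)).subscheme.presheaf.stalk x)) ∧ (GoodAt ((CategoryTheory.CategoryStruct.comp σ₂ r₁)) ((AlgebraicGeometry.Scheme.IdealSheafData.vanishingIdeal (⟨closure S₂, isClosed_closure⟩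 : TopologicalSpace.Closeds P₂)).subschemeι z) ↔ GoodAt r₁ ((AlgebraicGeometry.Scheme.IdealSheafData.vanishingIdeal (⟨closure S₁, isClosed_closure⟩ : TopologicalSpace.Closeds P₁)).subschemeι x))) →
    IsolatedPointDrop := by
  classical
  intro h1 h2 O _ _ _ _ _ _ P P₁ q Y σ₁ S₁ hq hqp hY hYirr hch₁ hirr₁ hfin₁ hgood₁ hne
  obtain ⟨x₀, hx₀⟩ := hne
  obtain ⟨P₂, σ₂, S₂, hch₂, hirr₂, V, hV, hiso, hreg₀⟩ :=
    h1 O P P₁ q Y σ₁ S₁ hq hqp hY hYirr hch₁ hirr₁ hfin₁ hgood₁ x₀ hx₀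
  -- generic points: `Y = closure {ξ}`, `closure S₁ = closure {ξ₁}`, `S₂ = closure {ξ₂}`, `σ₂ ξ₂ = ξ₁`
  obtain ⟨ξ, hξ⟩ : ∃ ξ : P, IsGenericPoint ξ (Y : Set P) := QuasiSober.sober hYirr Y.isClosed
  obtain ⟨ξ₁, hfib₁, hS₁⟩ := Chain.fibre hch₁ hξ
  have hcl₁ : closure S₁ = closure {ξ₁} := by rw [hS₁, closure_closure]
  have hgen₁ : IsGenericPoint ξ₁ (closure S₁) := by rw [isGenericPoint_def, hcl₁]
  have hirrS₁ : IsIrreducible (closure S₁) := by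
    rw [hcl₁]; exact isIrreducible_singleton.closure
  obtain ⟨ξ₂, hfib₂, hS₂⟩ := Chain.fibre hch₂ hgen₁
  have hσξ₂ : σ₂ ξ₂ = ξ₁ := by
    have : ξ₂ ∈ σ₂ ⁻¹' {ξ₁} := by rw [hfib₂]; rfl
    simpa using this
  -- the two reduced strict transforms and their inclusions
  have hrange₁ : Set.range (AlgebraicGeometry.Scheme.IdealSheafData.vanishingIdeal (⟨closure S₁, isClosed_closure⟩ : TopologicalSpace.Closeds P₁)).subschemeι = closure S₁ := by
    rw [Scheme.IdealSheafData.range_subschemeι, Scheme.IdealSheafData.coe_support_vanishingIdeal]; rfl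
  have hrange₂ : Set.range (AlgebraicGeometry.Scheme.IdealSheafData.vanishingIdeal (⟨closure S₂, isClosed_closure⟩ : TopologicalSpace.Closeds P₂)).subschemeι = closure S₂ := by
    rw [Scheme.IdealSheafData.range_subschemeι, Scheme.IdealSheafData.coe_support_vanishingIdeal]; rfl
  -- every point of the new strict transform lies over the old one
  have hcl₂ : closure S₂ = closure {ξ₂} := by rw [hS₂, closure_closure]
  have himg : ∀ z : ↥(AlgebraicGeometry.Scheme.IdealSheafData.vanishingIdeal (⟨closure S₂, isClosed_closure⟩ : TopologicalSpace.Closeds P₂)).subscheme, (σ₂ ((AlgebraicGeometry.Scheme.IdealSheafData.vanishingIdeal (⟨closure S₂, isClosed_closure⟩ : TopologicalSpace.Closeds P₂)).subschemeι z) : P₁) ∈ closure S₁ := by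
    intro z
    have hz : ((AlgebraicGeometry.Scheme.IdealSheafData.vanishingIdeal (⟨closure S₂, isClosed_closure⟩ : TopologicalSpace.Closeds P₂)).subschemeι z : P₂) ∈ closure S₂ := (Set.ext_iff.mp hrange₂ _).mp (Set.mem_range_self z)
    have hz' : ((AlgebraicGeometry.Scheme.IdealSheafData.vanishingIdeal (⟨closure S₂, isClosed_closure⟩ : TopologicalSpace.Closeds P₂)).subschemeι z : P₂) ∈ closure ({ξ₂} : Set P₂) := (Set.ext_iff.mp hcl₂ _).mp hz
    have h' : (σ₂ ((AlgebraicGeometry.Scheme.IdealSheafData.vanishingIdeal (⟨closure S₂, isClosed_closure⟩ : TopologicalSpace.Closeds P₂)).subschemeι z) : P₁) ∈ closure (σ₂ '' {ξ₂}) :=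
      image_closure_subset_closure_image σ₂.continuous ⟨_, hz', rfl⟩
    rw [Set.image_singleton, hσξ₂] at h'
    exact (Set.ext_iff.mp hcl₁ _).mpr h'
  have hx : ∀ z : ↥(AlgebraicGeometry.Scheme.IdealSheafData.vanishingIdeal (⟨closure S₂, isClosed_closure⟩ : TopologicalSpace.Closeds P₂)).subscheme, ∃ x : ↥(AlgebraicGeometry.Scheme.IdealSheafData.vanishingIdeal (⟨closure S₁, isClosed_closure⟩ : TopologicalSpace.Closeds P₁)).subscheme, ((AlgebraicGeometry.Scheme.IdealSheafData.vanishingIdeal (⟨closure S₁, isClosed_closure⟩ : TopologicalSpace.Closeds P₁)).subschemeι x : P₁) = σ₂ ((AlgebraicGeometry.Scheme.IdealSheafData.vanishingIdeal (⟨closure S₂, isClosed_closure⟩ : TopologicalSpace.Closeds P₂)).subschemeι z) := by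
    intro z
    have hz : (σ₂ ((AlgebraicGeometry.Scheme.IdealSheafData.vanishingIdeal (⟨closure S₂, isClosed_closure⟩ : TopologicalSpace.Closeds P₂)).subschemeι z) : P₁) ∈ Set.range (AlgebraicGeometry.Scheme.IdealSheafData.vanishingIdeal (⟨closure S₁, isClosed_closure⟩ : TopologicalSpace.Closeds P₁)).subschemeι := (Set.ext_iff.mp hrange₁ _).mpr (himg z)
    obtain ⟨x, hx⟩ := hz
    exact ⟨x, hx⟩
  choose f hf using hx
  -- `f` maps the new non-regular points into the old ones minus `x₀`, injectively
  have hne₀ : ∀ z ∈ singSet S₂, f z ≠ x₀ := by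
    intro z hz h0
    exact hz (hreg₀ z (by rw [← hf z, h0]))
  have hfV : ∀ z ∈ singSet S₂, ((AlgebraicGeometry.Scheme.IdealSheafData.vanishingIdeal (⟨closure S₁, isClosed_closure⟩ : TopologicalSpace.Closeds P₁)).subschemeι (f z) : P₁) ∈ V := fun z hz => hV (f z) (hne₀ z hz)
  have hmaps : ∀ z ∈ singSet S₂, f z ∈ singSet S₁ \ {x₀} := by
    intro z hz
    refine ⟨?_, hne₀ z hz⟩
    intro hreg
    exact hz ((h2 O P₁ P₂ ((CategoryTheory.CategoryStruct.comp σ₁ q)) σ₂ S₁ S₂ V hirrS₁ hch₂ hiso z (f z) (hf z).symm (hfV z hz)).1.mpr hreg)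
  have hinj : Set.InjOn f (singSet S₂) := by
    intro z hz z' hz' hzz'
    obtain ⟨w, -, huniq⟩ := existsUnique_preimage σ₂ hiso (hfV z hz)
    have e1 : ((AlgebraicGeometry.Scheme.IdealSheafData.vanishingIdeal (⟨closure S₂, isClosed_closure⟩ : TopologicalSpace.Closeds P₂)).subschemeι z : P₂) = w := huniq _ (hf z).symm
    have e2 : ((AlgebraicGeometry.Scheme.IdealSheafData.vanishingIdeal (⟨closure S₂, isClosed_closure⟩ : TopologicalSpace.Closeds P₂)).subschemeι z' : P₂) = w := huniq _ (by rw [hzz', hf z'])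
    exact (AlgebraicGeometry.Scheme.IdealSheafData.vanishingIdeal (⟨closure S₂, isClosed_closure⟩ : TopologicalSpace.Closeds P₂)).subschemeι.isClosedEmbedding.injective (e1.trans e2.symm)
  have hfin' : (singSet S₁ \ {x₀}).Finite := hfin₁.subset Set.diff_subset
  have hfin₂ : (singSet S₂).Finite := by
    have himf : (f '' singSet S₂).Finite := hfin'.subset (by rintro _ ⟨z, hz, rfl⟩; exact hmaps z hz)
    exact (Set.finite_image_iff hinj).mp himf
  have hle : (singSet S₂).ncard ≤ (singSet S₁ \ {x₀}).ncard := Set.ncard_le_ncard_of_injOn f hmaps hinj hfin'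
  have hlt : (singSet S₁ \ {x₀}).ncard < (singSet S₁).ncard := Set.ncard_sdiff_singleton_lt_of_mem hx₀ hfin₁
  -- good reduction at the remaining non-regular points is inherited from the points under them
  have hgood₂ : GoodSet ((CategoryTheory.CategoryStruct.comp (CategoryTheory.CategoryStruct.comp σ₂ σ₁) q)) S₂ := by
    intro z hz
    have hg : GoodAt ((CategoryTheory.CategoryStruct.comp σ₁ q)) ((AlgebraicGeometry.Scheme.IdealSheafData.vanishingIdeal (⟨closure S₁, isClosed_closure⟩ : TopologicalSpace.Closeds P₁)).subschemeι (f z)) := hgood₁ (f z) (hmaps z hz).1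
    have ht := (h2 O P₁ P₂ ((CategoryTheory.CategoryStruct.comp σ₁ q)) σ₂ S₁ S₂ V hirrS₁ hch₂ hiso z (f z) (hf z).symm (hfV z hz)).2.mpr hg
    rwa [← Category.assoc] at ht
  exact ⟨P₂, σ₂, S₂, hch₂, hirr₂, hfin₂, hgood₂, lt_of_le_of_lt hle hlt⟩

/-- The child, assembled from the two registered stubs (only `sorry`s in its closure: the two stubs). -/
theorem IsolatedPointDrop_proof : IsolatedPointDrop :=
  IsolatedPointDrop_of stub_resolveOnePoint stub_regularOverIso

end Summit.ResolutionOfSingularities.ResolutionOfSingularities.Cruxes.IsolatedPointDrop.Birth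

end
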